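import Summits.CriticalPhenomena.PercolationContinuityZ3.Theorems.PercNearOneGluingNoHeavyPcintOSMSiteBridge
import Summits.CriticalPhenomena.PercolationContinuityZ3.Theorems.PercNearOneGluingNoHeavyPcintOSMCompute
import Literature.Probability.Percolation.SiteSharpnessDecay
import Literature.Probability.Percolation.SiteCoveringStrictMonotonicityAssembly
import HarnessLib

/-!
# PCINT lane, PHASE 4 (kernel second-moment oriented route), site version, step 3: the bound assembled

Cell `prim-pcint`, seat `prim-pcint-1` (gen 13); memo `run/shared/lean/prim/pcint/T-FIBRE-ROUTE.md` §PHASE 4.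

**`OSM.siteCriticalProb_le_of_green`**: if `Σ_{k<n} u d k ≤ G` for every `n`, then `p_c^site(ℤ^d) ≤ (G − 1)/G = 1 − 1/G`.
For `p > 1 − 1/G` one has `(1/p − 1)(G − 1) < 1`; the site renewal bound (`OSM.SV_zero_le`) and the site bridge
(`OSM.le_real_exitEvent`) give `P_p(0 ⟷ ∂ⁱⁿB(0,n)) ≥ p (1 − (1/p−1)(G−1)) > 0` for every graph ball `B(0, n)`, hence
`θ^site(p) > 0` (`tendsto_siteTheta` along the graph balls) and `p_c^site ≤ p`.  This is the site analogue of the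
Cox–Durrett oriented second-moment bound (shared VERTICES of two independent oriented walks are geometric with mean
`G − 1`).  Kernel form: **`OSM.siteCriticalProb_le_of_checkOSMsite`** with
`checkOSMsite d q₀ P := (GplusQ d q₀ · (10⁴ − P) ≤ 10⁴)`.
-/

noncomputable section

namespace Summit.CriticalPhenomena.PercolationContinuityZ3.Theorems.Pcint.OSM

open Finset Filter Topology MeasureTheory Literature.Probability.Percolation Literature.Probability.LatticeModels

variable {d : ℕ}

/-- **Positivity of `θ^site` above the second-moment threshold**: if `Σ_{k<n} u d k ≤ G` for all `n` and
`(1/p − 1)(G − 1) < 1`, then `θ^site(p) ≥ p (1 − (1/p − 1)(G − 1)) > 0`. -/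
theorem le_siteTheta [NeZero d] {G : ℝ} (hG : ∀ n, ∑ k ∈ range n, u d k ≤ G) (p : unitInterval) (hp : 0 < (p : ℝ))
    (hc : (1 / (p : ℝ) - 1) * (G - 1) < 1) :
    (p : ℝ) * (1 - (1 / (p : ℝ) - 1) * (G - 1)) ≤ siteTheta (zdGraph d) (0 : Site d) p := by
  have hd : 0 < d := Nat.pos_of_ne_zero (NeZero.ne d)
  have hdR : (0 : ℝ) < d := by exact_mod_cast hd
  have hx : (1 : ℝ) ≤ 1 / (p : ℝ) := by rw [le_div_iff₀ hp, one_mul]; exact p.2.2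
  -- the bound for every graph ball
  have hball : ∀ n : ℕ, (p : ℝ) * (1 - (1 / (p : ℝ) - 1) * (G - 1)) ≤
      (sitePercolation (Site d) p).real (exitEvent (zdGraph d) (DCTQ.ball (zdGraph d) (0 : Site d) n) (0 : Site d)) := by
    intro n
    refine le_trans ?_ (le_real_exitEvent p hp n)
    have hS := SV_zero_le hd hx hG hc n
    have hpos : 0 < 1 - (1 / (p : ℝ) - 1) * (G - 1) := by linarith
    have hSpos : 0 < SV d (1 / p) n 0 := by
      unfold SV
      exact Finset.sum_pos (fun w _ => Finset.sum_pos (fun w' _ => by positivity) univ_nonempty) univ_nonempty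
    rw [le_div_iff₀ hSpos]
    calc (p : ℝ) * (1 - (1 / (p : ℝ) - 1) * (G - 1)) * SV d (1 / p) n 0
        ≤ (p : ℝ) * (1 - (1 / (p : ℝ) - 1) * (G - 1)) * ((d : ℝ) ^ (2 * n) / (1 - (1 / (p : ℝ) - 1) * (G - 1))) :=
          mul_le_mul_of_nonneg_left hS (mul_nonneg hp.le hpos.le)
      _ = (p : ℝ) * (d : ℝ) ^ (2 * n) := by
          rw [mul_assoc, mul_div_assoc', mul_div_cancel_left₀ _ hpos.ne']
  -- the graph balls exhaust `ℤ^d`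
  have hmono : Monotone (fun k : ℕ => DCTQ.ball (zdGraph d) (0 : Site d) k) := fun a b hab => DCTQ.ball_mono 0 hab
  have hex : ∀ v : Site d, ∃ k, v ∈ DCTQ.ball (zdGraph d) (0 : Site d) k := fun v => by
    obtain ⟨q⟩ := zdGraph_preconnected_holds (d := d) (0 : Site d) v
    exact ⟨q.length, DCTQ.mem_ball_of_walk q le_rfl⟩
  have h00 : (0 : Site d) ∈ DCTQ.ball (zdGraph d) (0 : Site d) 0 := DCTQ.mem_ball_self _ _
  have hlim := tendsto_siteTheta (G := zdGraph d) hmono hex h00 p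
  have heq : ∀ k : ℕ, (⋂ i ≤ k, exitEvent (zdGraph d) (DCTQ.ball (zdGraph d) (0 : Site d) i) (0 : Site d)) =
      exitEvent (zdGraph d) (DCTQ.ball (zdGraph d) (0 : Site d) k) (0 : Site d) := by
    intro k
    apply Set.Subset.antisymm
    · intro ω hω; exact (Set.mem_iInter₂.1 hω) k le_rfl
    · exact Set.subset_iInter₂ fun i hi => exitEvent_anti (hmono hi) (DCTQ.mem_ball_self _ _)
  simp_rw [heq] at hlim
  exact ge_of_tendsto' hlim hball

/-- **The site second-moment bound**: `Σ_{k<n} u d k ≤ G` for all `n` implies `p_c^site(ℤ^d) ≤ (G − 1)/G`. -/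
theorem siteCriticalProb_le_of_green [NeZero d] {G : ℝ} (hG : ∀ n, ∑ k ∈ range n, u d k ≤ G) :
    siteCriticalProb (zdGraph d) (0 : Site d) ≤ (G - 1) / G := by
  have hG1 : 1 ≤ G := by
    have := hG 1
    rw [Finset.sum_range_one, u_zero] at this
    exact this
  have hGpos : 0 < G := by linarith
  refine le_of_forall_gt_imp_ge_of_dense fun t ht => ?_
  by_cases ht1 : t ≤ 1
  · have hρ0 : 0 ≤ (G - 1) / G := div_nonneg (by linarith) hGpos.le
    have ht0 : 0 < t := lt_of_le_of_lt hρ0 ht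
    have hc : (1 / t - 1) * (G - 1) < 1 := by
      have h1 : G - 1 < t * G := by rwa [div_lt_iff₀ hGpos] at ht
      have : (1 / t - 1) * (G - 1) = ((G - 1) - t * (G - 1)) / t := by field_simp
      rw [this, div_lt_iff₀ ht0]
      nlinarith
    have hθ := le_siteTheta hG ⟨t, ht0.le, ht1⟩ ht0 hc
    have hpos : 0 < siteTheta (zdGraph d) (0 : Site d) ⟨t, ht0.le, ht1⟩ :=
      lt_of_lt_of_le (mul_pos ht0 (by linarith)) hθ
    exact SiteOrbitQuotient.siteCriticalProb_le_of_siteTheta_pos (zdGraph d) 0 ⟨t, ht0.le, ht1⟩ hpos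
  · exact (siteCriticalProb_mem_Icc _ _).2.trans (le_of_not_ge ht1)

/-- **Kernel form (sites)**: for `d ≥ 5`, `q₀ ≥ 1`, `g ≥ Gplus d q₀` and `c ≥ (g−1)/g`, `p_c^site(ℤ^d) ≤ c`. -/
theorem siteCriticalProb_le_of_Gplus_le (hd : 5 ≤ d) {q₀ : ℕ} (hq₀ : 1 ≤ q₀) {g c : ℝ} (hg : Gplus d q₀ ≤ g)
    (hc : (g - 1) / g ≤ c) : siteCriticalProb (zdGraph d) (0 : Site d) ≤ c := by
  haveI : NeZero d := ⟨by omega⟩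
  have hG1 : 1 ≤ Gplus d q₀ := by
    have := sum_u_le_Gplus hd hq₀ 1
    rw [Finset.sum_range_one, u_zero] at this
    exact this
  refine (siteCriticalProb_le_of_green (sum_u_le_Gplus hd hq₀)).trans (le_trans ?_ hc)
  -- `G ↦ (G-1)/G` is non-decreasing on `G > 0`
  rw [div_le_div_iff₀ (by linarith) (by linarith)]
  nlinarith

/-- **The kernel check (sites)** for the cell `P/10⁴`: `GplusQ · (10⁴ − P) ≤ 10⁴`, i.e. `(GplusQ − 1)/GplusQ ≤ P/10⁴`. -/
def checkOSMsite (d q₀ P : ℕ) : Bool :=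
  decide (GplusQ d q₀ * (10000 - (P : ℚ)) ≤ 10000)

/-- **From the kernel check to the site cell**: `checkOSMsite d q₀ P = true → p_c^site(ℤ^d) ≤ P/10⁴`. -/
theorem siteCriticalProb_le_of_checkOSMsite {d q₀ P : ℕ} (hd : 5 ≤ d) (hq₀ : 1 ≤ q₀) (hP : P < 10000)
    (h : checkOSMsite d q₀ P = true) :
    siteCriticalProb (zdGraph d) (0 : Site d) ≤ (P : ℝ) / 10000 := by
  have hq : GplusQ d q₀ * (10000 - (P : ℚ)) ≤ 10000 := of_decide_eq_true h
  have hR : Gplus d q₀ * (10000 - (P : ℝ)) ≤ 10000 := by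
    rw [← GplusQ_cast]; exact_mod_cast hq
  have hG1 : 1 ≤ Gplus d q₀ := by
    haveI : NeZero d := ⟨by omega⟩
    have := sum_u_le_Gplus hd hq₀ 1
    rw [Finset.sum_range_one, u_zero] at this
    exact this
  have hP' : (P : ℝ) < 10000 := by exact_mod_cast hP
  refine siteCriticalProb_le_of_Gplus_le hd hq₀ le_rfl ?_
  rw [div_le_div_iff₀ (by linarith) (by norm_num)]
  nlinarith

end Summit.CriticalPhenomena.PercolationContinuityZ3.Theorems.Pcint.OSM

end
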